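import Summits.AnomalousDissipation.AnomalousDissipation.Theorems.PumpedMirrorMirrorFloorTGExplicitEnergy
import Summits.AnomalousDissipation.AnomalousDissipation.Theorems.PumpedMirrorMirrorFloorTGDuality
import Summits.AnomalousDissipation.AnomalousDissipation.Theorems.PumpedMirrorMirrorFloorTGWeakDuality
import Summits.AnomalousDissipation.AnomalousDissipation.Theorems.PumpedMirrorMirrorFloorTGReducedCrux

/-!
# Strategist census, gen 1 / seat r1 (redirect second opinion) — typed companion
# (crux `PumpedMirror.MirrorFloorTG`, stmt-AnomalousDissipation-15372)

Companion of `Cruxes/MirrorFloorTG/STRATEGY-CENSUS.md`, Part III (seat r1, 2026-08-17). Everything here is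
kernel-checked (`lean check` rc 0, no `sorry`); statements are over tree vocabulary and the landed theorems of the
line `registered` (`…Theorems.PumpedMirrorMirrorFloorTG.*`, p143356 … p151877).

* §R0 vocabulary (`IsTG`, `IsRelaxedK`, `MirrorLawsLoudK` — verbatim the bundles of seat b1, so that the three
  census files interoperate) and `mirrorLawsLoudK_iff_mirrorFloorTG` (the landed CRUX ⟺ S3, bundled).
* §R1 [DECOMPOSITION / re-target] `RestFamilyFloorTG` — the REALISABLE sub-crux: the floor asked only along
  K-symmetric Leray–Hopf solutions of `NS_ν(f_TG)` FROM REST whose lift stays in the `E`-ball (no certificate, no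
  relaxed statistics). PROVED: `restFamilyFloorTG_of_mirrorFloorTG : MirrorFloorTG → RestFamilyFloorTG` (the
  floor transfer of the route's `closes`, isolated) and
  `anomalousDissipation_of_restFamilyFloorTG : RestFamilyFloorTG → MirrorBoundedFromRestTG → AnomalousDissipation`
  (the route's `closes` factors through the sub-crux). So the crux is STRICTLY MORE than the deciding theorem
  consumes; `RestFamilyFloorTG` is the largest sub-crux that still closes the route with crux #3 (tribunal re-target).
* §R2 [STRENGTHEN / ladder] `FreeFloorPowerK a` — "every relaxed K-statistic of `f_TG` below `E` dissipates
  `≥ c ν^{1-a}`": rung `a = 0` is LANDED (`freeFloorPowerK_zero`, from `fixedViscosity_floor_explicit`), rung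
  `a = 1` IS the crux (`freeFloorPowerK_one_iff`), rungs are monotone (`FreeFloorPowerK.anti`); no rung with
  `0 < a` is known for any steadily forced 3-D flow (census S11: the ladder ceiling).
* §R3 [STRENGTHEN / dominating hypothesis] `StatDragLawK` — Kolmogorov's dimensionless law `ε ≥ c U³` for relaxed
  K-statistics; PROVED `mirrorLawsLoudK_of_statDragLawK : StatDragLawK → MirrorLawsLoudK` via the anti-pumping
  MEAN-ENERGY floor `meanEnergy_floor_of_relaxed` (`∫|u|²dμ ≥ 1/(16π)` for every relaxed statistic of `f_TG` with
  `ε(μ) ≤ 1`, `ν ≤ ν_*`): the natural dominating hypothesis of the crux is the summit's own dimensionless form.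
* §R4 [STRENGTHEN / Euler level] `UniformCertificateLevelTG E` — the ν-UNIFORM certificate at level `E`
  (quantifier swap `∃(Φ₁,θ₁) ∀ν`); PROVED below `1/(8π)` (`uniformCertificateLevelTG_below_inv_eight_pi`) and
  `uniformCertificateLevelTG.floorAt` (it gives the crux's conclusion at that level); census S13 records the
  paper-level theorem that its reach is EXACTLY the linear reach `E_lin ≤ 0.1225` (microstructure at the origin
  fibre), i.e. the ν-free strengthening is dead at every level the route needs.
-/

noncomputable section

set_option linter.dupNamespace false

namespace Summit.AnomalousDissipation.AnomalousDissipation.Cruxes.MirrorFloorTG.StrategistCensusR1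

open MeasureTheory Filter Topology Set Function UnitAddTorus
open scoped InnerProductSpace RealInnerProductSpace ENNReal NNReal Topology
open Literature.Analysis.FunctionSpaces Literature.Analysis.FluidPDE
open Summit.AnomalousDissipation.AnomalousDissipation.Theses.PumpedMirror
open Summit.AnomalousDissipation.AnomalousDissipation.Theorems.TaylorGreenLoudGalerkinStates.Negative
  (tgForce isSmooth_tgForce isDivFree_tgForce hasZeroMean_tgForce integral_norm_sq_tgForce continuous_tgForce)
open Summit.AnomalousDissipation.AnomalousDissipation.Theorems.PumpedMirrorMirrorFloorTG
  (mirrorFloorTG_of_mirrorLawsLoudTG mirrorLawsLoudTG_of_mirrorFloorTG antiPumping_tg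
    fixedViscosity_floor_explicit abs_inertialPairing_tgForce_le_energy floor_uniform_below_inv_eight_pi)
open Summit.AnomalousDissipation.AnomalousDissipation.Theorems.GPStatisticalRigidity.Negative
  (integrable_norm_sq_of_ensembleEnstrophy_lt_top)

/-! ## §R0 Vocabulary (verbatim the bundles of `StrategistCensusB1`) -/

/-- The pinned Taylor–Green force as the route spells it. -/
def IsTG (f : UnitAddTorus (Fin 3) → EuclideanSpace ℝ (Fin 3)) : Prop :=
  f = (fun x => !₂[(fourier 1 (x 0) : ℂ).im * (fourier 1 (x 1) : ℂ).re * (fourier 1 (x 2) : ℂ).re,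
    -((fourier 1 (x 0) : ℂ).re * (fourier 1 (x 1) : ℂ).im * (fourier 1 (x 2) : ℂ).re), (0 : ℝ)])

theorem isTG_iff_eq_tgForce (f : UnitAddTorus (Fin 3) → EuclideanSpace ℝ (Fin 3)) : IsTG f ↔ f = tgForce := Iff.rfl

theorem isTG_tgForce : IsTG tgForce := rfl

/-- **Relaxed stationary K-statistics of `NS_ν(f)` below energy `E`** (the seven hypotheses of the registered stub,
bundled; verbatim `StrategistCensusB1.IsRelaxedK`). -/
def IsRelaxedK (ν E : ℝ) (f : UnitAddTorus (Fin 3) → EuclideanSpace ℝ (Fin 3))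
    (μ : Measure (Torus.energySpace (Fin 3))) : Prop :=
  IsProbabilityMeasure μ ∧
  (∀ᵐ u ∂μ, ∀ i j : Fin 3,
    (fun x => (u.1 : UnitAddTorus (Fin 3) → EuclideanSpace ℝ (Fin 3)) (Function.update x i (-x i)) j)
      =ᵐ[volume]
    (fun x => if j = i then -((u.1 : UnitAddTorus (Fin 3) → EuclideanSpace ℝ (Fin 3)) x j)
      else (u.1 : UnitAddTorus (Fin 3) → EuclideanSpace ℝ (Fin 3)) x j)) ∧
  (∀ᵐ u ∂μ, ‖u‖ ^ 2 ≤ E) ∧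
  Torus.ensembleEnstrophy μ < ⊤ ∧
  (∀ Φ : Torus.CylindricalTest (Fin 3),
    Integrable (fun u => Torus.nsGeneratorPairing ν f u (Φ.grad u)) μ ∧
      ∫ u, Torus.nsGeneratorPairing ν f u (Φ.grad u) ∂μ = 0) ∧
  Integrable (fun u : Torus.energySpace (Fin 3) => Torus.pairing u.1 f) μ ∧
  Torus.ensembleDissipation ν μ ≤ ∫ u, Torus.pairing u.1 f ∂μ

/-- The registered stub S3 (≡ the crux), bundled form. -/
def MirrorLawsLoudK : Prop :=
  ∀ f, IsTG f → ∀ E : ℝ, 0 < E → ∃ ε₀ ν₀ : ℝ, 0 < ε₀ ∧ 0 < ν₀ ∧ ∀ ν : ℝ, 0 < ν → ν < ν₀ →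
    ∀ μ : Measure (Torus.energySpace (Fin 3)), IsRelaxedK ν E f μ → ε₀ ≤ Torus.ensembleDissipation ν μ

/-- **CRUX ⟺ S3 (bundled)** — the landed strong duality `mirrorFloorTG_iff_mirrorLawsLoudTG` (p146584). -/
theorem mirrorLawsLoudK_iff_mirrorFloorTG : MirrorLawsLoudK ↔ MirrorFloorTG := by
  constructor
  · intro h
    refine mirrorFloorTG_of_mirrorLawsLoudTG ?_
    intro f hf E hE
    obtain ⟨ε₀, ν₀, hε₀, hν₀, hL⟩ := h f hf E hE
    exact ⟨ε₀, ν₀, hε₀, hν₀, fun ν hν hνlt μ hP hsym hball hG hLi hW hEI =>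
      hL ν hν hνlt μ ⟨hP, hsym, hball, hG, hLi, hW, hEI⟩⟩
  · intro hA f hf E hE
    obtain ⟨ε₀, ν₀, hε₀, hν₀, hL⟩ := mirrorLawsLoudTG_of_mirrorFloorTG hA f hf E hE
    exact ⟨ε₀, ν₀, hε₀, hν₀, fun ν hν hνlt μ hμ =>
      hL ν hν hνlt μ hμ.1 hμ.2.1 hμ.2.2.1 hμ.2.2.2.1 hμ.2.2.2.2.1 hμ.2.2.2.2.2.1 hμ.2.2.2.2.2.2⟩

/-! ## §R1 The REALISABLE sub-crux `RestFamilyFloorTG` and the factorisation of `closes` through it -/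

/-- **`RestFamilyFloorTG` — the zeroth law for the Taylor–Green flow from rest, conditional on its energy level.**
For `f = f_TG` and every level `E > 0` there are `ε₀, ν₀ > 0` such that for every `ν ∈ (0, ν₀)` EVERY global
Leray–Hopf solution of `NS_ν(f_TG)` from the zero datum, with an `H`-lift `U` (a.e. equal, K-symmetric a.e.) staying
in `{‖U t‖² ≤ E}` for all `t ≥ 0`, has `meanDissipation ν u ≥ ε₀`. No certificate, no relaxed statistics: the
enemy must be the actual Taylor–Green dynamics from rest being quiet. Strictly weaker than the crux
(`restFamilyFloorTG_of_mirrorFloorTG`) and still closing the route with crux #3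
(`anomalousDissipation_of_restFamilyFloorTG`). -/
def RestFamilyFloorTG : Prop :=
  ∀ f : UnitAddTorus (Fin 3) → EuclideanSpace ℝ (Fin 3), IsTG f → ∀ E : ℝ, 0 < E →
    ∃ ε₀ ν₀ : ℝ, 0 < ε₀ ∧ 0 < ν₀ ∧ ∀ ν : ℝ, 0 < ν → ν < ν₀ →
      ∀ (u : ℝ → UnitAddTorus (Fin 3) → EuclideanSpace ℝ (Fin 3)) (U : ℝ → Torus.energySpace (Fin 3)),
        Torus.IsGlobalLerayHopf ν (fun _ => f) 0 u →
        (∀ t, 0 ≤ t → ((U t : Lp (EuclideanSpace ℝ (Fin 3)) 2 (volume : Measure (UnitAddTorus (Fin 3)))) :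
          UnitAddTorus (Fin 3) → EuclideanSpace ℝ (Fin 3)) =ᵐ[volume] u t) →
        (∀ t, 0 ≤ t → ∀ i j : Fin 3,
          (fun x => ((U t : Lp (EuclideanSpace ℝ (Fin 3)) 2 (volume : Measure (UnitAddTorus (Fin 3)))) :
            UnitAddTorus (Fin 3) → EuclideanSpace ℝ (Fin 3)) (Function.update x i (-x i)) j) =ᵐ[volume]
          (fun x => if j = i then
            -(((U t : Lp (EuclideanSpace ℝ (Fin 3)) 2 (volume : Measure (UnitAddTorus (Fin 3)))) :
              UnitAddTorus (Fin 3) → EuclideanSpace ℝ (Fin 3)) x j)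
            else ((U t : Lp (EuclideanSpace ℝ (Fin 3)) 2 (volume : Measure (UnitAddTorus (Fin 3)))) :
              UnitAddTorus (Fin 3) → EuclideanSpace ℝ (Fin 3)) x j)) →
        (∀ t, 0 ≤ t → ‖U t‖ ^ 2 ≤ E) →
        ε₀ ≤ Literature.Analysis.FluidPDE.meanDissipation ν u

/-- **The crux implies the realisable sub-crux** (the floor transfer of the route's `closes`, isolated: floor a.e.
in `t` along the lift, energy inequality from the zero datum, generator Cesàro mean `→ 0`, limsup comparison). -/
theorem restFamilyFloorTG_of_mirrorFloorTG (hA : MirrorFloorTG) : RestFamilyFloorTG := by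
  intro f hf E hE
  have hf' : f = tgForce := hf
  subst hf'
  obtain ⟨ε₀, ν₀, hε₀, hν₀, hfl⟩ := hA tgForce rfl E hE
  refine ⟨ε₀, ν₀, hε₀, hν₀, fun ν hν hνlt u U hLH hl hsym hbd => ?_⟩
  obtain ⟨Φ, θ, hθ, hflo⟩ := hfl ν hν hνlt
  have hfL2 : MemLp tgForce 2 (volume : Measure (UnitAddTorus (Fin 3))) := isSmooth_tgForce.memLp 2
  have hfz : Torus.HasZeroMean tgForce := hasZeroMean_tgForce
  set D : ℝ → ℝ := fun t => ν * (Torus.eGradNormSq (u t)).toReal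
  set G : ℝ → ℝ := fun t => Torus.nsGeneratorPairing ν tgForce (U t) (Φ.grad (U t))
  set P : ℝ → ℝ := fun t => ∫ x, inner ℝ (tgForce x) (u t x)
  set K : ℝ := 2 * ((4 * Real.pi ^ 2 * ν)⁻¹ / 2 * ∫ x, ‖tgForce x‖ ^ 2) with hK
  have hPt : ∀ t, 0 ≤ t → Torus.pairing (U t).1 tgForce = P t := fun t ht0 => by
    rw [Torus.pairing_lift_eq hl tgForce ht0]
    exact integral_congr_ae (ae_of_all _ fun x => real_inner_comm _ _)
  have hAE : ∀ T, 0 < T → ∀ᵐ t ∂(volume.restrict (Ioc 0 T)), ε₀ ≤ D t + G t + 2 * θ * (P t - D t) := by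
    intro T hT
    have hL := hLH T hT
    have hae := ae_lt_top' hL.aemeasurable_eGradNormSq hL.lintegral_eGradNormSq_lt_top.ne
    rw [← Measure.restrict_congr_set (Ioo_ae_eq_Ioc (μ := (volume : Measure ℝ)))]
    filter_upwards [hae, ae_restrict_mem measurableSet_Ioo] with t ht htmem
    have ht0 : 0 ≤ t := htmem.1.le
    have hcg : Torus.eGradNormSq ((U t).1 : UnitAddTorus (Fin 3) → EuclideanSpace ℝ (Fin 3)) =
        Torus.eGradNormSq (u t) := by
      unfold Torus.eGradNormSq Torus.eHomSobolevSeminorm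
      simp_rw [Torus.mFourierCoeff_congr_ae ((hl t ht0).fun_comp _)]
    have h := hflo (U t) (hsym t ht0) (by rw [hcg]; exact ht.ne) (hbd t ht0)
    rw [hcg, hPt t ht0] at h
    exact h
  have key : ∀ T, 0 < T → ε₀ ≤ timeMean D T + timeMean G T ∧ timeMean D T ≤ K := by
    intro T hT
    have hL := hLH T hT
    have hDI : IntegrableOn D (Ioc 0 T) :=
      (intervalIntegrable_iff_integrableOn_Ioc_of_le hT.le).1 (hL.intervalIntegral_dissipation_eq hT).1
    have hGI : IntegrableOn G (Ioc 0 T) := hLH.integrableOn_generator hfL2 hl Φ hT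
    have hPI : IntegrableOn P (Ioc 0 T) :=
      (intervalIntegrable_iff_integrableOn_Ioc_of_le hT.le).1 (hL.intervalIntegrable_power hT hν hfL2 hfz)
    have hI : ∫ _ in Ioc 0 T, ε₀ ≤ ∫ t in Ioc 0 T, (D t + G t + 2 * θ * (P t - D t)) :=
      integral_mono_ae (integrable_const _) ((hDI.add hGI).add ((hPI.sub hDI).const_mul _)) (hAE T hT)
    rw [setIntegral_const, Real.volume_real_Ioc_of_le hT.le, sub_zero, smul_eq_mul,
      integral_add (f := fun t => D t + G t) (g := fun t => 2 * θ * (P t - D t)) (hDI.add hGI)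
        ((hPI.sub hDI).const_mul _), integral_add hDI hGI, integral_const_mul (2 * θ) (fun t => P t - D t),
      integral_sub hPI hDI] at hI
    have hEn := hL.intervalIntegral_dissipation_le hT
    obtain ⟨hDb, -⟩ := hL.intervalIntegral_power_bounds hT hν hfL2 hfz
    have hK0 : Torus.kineticEnergy (0 : UnitAddTorus (Fin 3) → EuclideanSpace ℝ (Fin 3)) = 0 := by
      simp [Torus.kineticEnergy]
    rw [hK0, intervalIntegral.integral_of_le hT.le, intervalIntegral.integral_of_le hT.le] at hEn
    rw [hK0, mul_zero, zero_add, ← hK, intervalIntegral.integral_of_le hT.le] at hDb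
    have hchan : 2 * θ * ((∫ t in Ioc 0 T, P t) - ∫ t in Ioc 0 T, D t) ≤ 0 := by
      have h1 : 0 ≤ (∫ t in Ioc 0 T, P t) - ∫ t in Ioc 0 T, D t := by linarith
      nlinarith [hθ]
    simp only [timeMean, intervalIntegral.integral_of_le hT.le]
    constructor
    · rw [← mul_add, le_inv_mul_iff₀ hT]; linarith
    · rw [inv_mul_le_iff₀ hT]; linarith
  have hlow : Tendsto (fun T : ℝ => ε₀ - timeMean G T) atTop (nhds ε₀) := by
    simpa using (hLH.tendsto_timeMean_generator hfL2 hl Φ).const_sub ε₀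
  have hle : ∀ᶠ T in atTop, ε₀ - timeMean G T ≤ timeMean D T :=
    (eventually_gt_atTop 0).mono fun T hT => by linarith [(key T hT).1]
  have hDle : ∀ᶠ T in atTop, timeMean D T ≤ K := (eventually_gt_atTop 0).mono fun T hT => (key T hT).2
  calc ε₀ = limsup (fun T : ℝ => ε₀ - timeMean G T) atTop := hlow.limsup_eq.symm
    _ ≤ limsup (timeMean D) atTop :=
      limsup_le_limsup hle hlow.isBoundedUnder_ge.isCoboundedUnder_le (isBoundedUnder_of_eventually_le hDle)
    _ = Literature.Analysis.FluidPDE.meanDissipation ν u := rfl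

/-- **The route's deciding theorem factors through the sub-crux**: `RestFamilyFloorTG` and crux #3 give the summit
(`ν_j := min(ν₀,ν₁)/(j+2)`; energies bounded by the pathwise lift bound, dissipations bounded below by the sub-crux). -/
theorem anomalousDissipation_of_restFamilyFloorTG (hR : RestFamilyFloorTG) (hB : MirrorBoundedFromRestTG) :
    _root_.AnomalousDissipation := by
  have hfs : Torus.IsSmooth tgForce := isSmooth_tgForce
  have hfd : Torus.IsDivFree tgForce := isDivFree_tgForce
  have hfz : Torus.HasZeroMean tgForce := hasZeroMean_tgForce
  obtain ⟨E, ν₁, hE, hν₁, hfam⟩ := hB tgForce rfl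
  obtain ⟨ε₀, ν₀, hε₀, hν₀, hfl⟩ := hR tgForce rfl E hE
  have hm : 0 < min ν₀ ν₁ := lt_min hν₀ hν₁
  set ν : ℕ → ℝ := fun j => min ν₀ ν₁ / ((j : ℝ) + 2) with hν
  have hνp : ∀ j, 0 < ν j := fun j => div_pos hm (by positivity)
  have hνlt : ∀ j, ν j < min ν₀ ν₁ := fun j => by
    rw [div_lt_iff₀ (by positivity : (0 : ℝ) < j + 2)]; nlinarith
  have hνlim : Tendsto ν atTop (nhds 0) := by
    simpa [hν, div_eq_mul_inv] using (tendsto_inv_atTop_zero.comp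
      (tendsto_atTop_add_const_right atTop (2 : ℝ) tendsto_natCast_atTop_atTop)).const_mul (min ν₀ ν₁)
  choose u U hLH hl hsym hbd using fun j => hfam (ν j) (hνp j) ((hνlt j).trans_le (min_le_right _ _))
  have hEn : ∀ j, Literature.Analysis.FluidPDE.meanEnergy (u j) ≤ E := by
    intro j
    have hg : ∀ t, 0 ≤ t → |∫ x, ‖u j t x‖ ^ 2| ≤ E := by
      intro t ht
      have h1 : ‖U j t‖ ^ 2 = ∫ x, ‖u j t x‖ ^ 2 := by
        rw [Submodule.coe_norm, ← real_inner_self_eq_norm_sq, L2.inner_def]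
        refine integral_congr_ae ?_
        filter_upwards [hl j t ht] with x hx
        rw [hx, real_inner_self_eq_norm_sq]
      rw [abs_of_nonneg (integral_nonneg fun x => by positivity), ← h1]
      exact hbd j t ht
    have hTM : ∀ T, 0 < T → |timeMean (fun t => ∫ x, ‖u j t x‖ ^ 2) T| ≤ E :=
      fun T hT => abs_timeMean_le hT fun t ht _ => hg t ht.le
    rw [meanEnergy_eq_longTimeAvgSup]
    exact limsup_le_of_le
      (isCoboundedUnder_le_of_eventually_le atTop
        ((eventually_gt_atTop 0).mono fun T hT => (abs_le.1 (hTM T hT)).1))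
      ((eventually_gt_atTop 0).mono fun T hT => (abs_le.1 (hTM T hT)).2)
  have hDiss : ∀ j, ε₀ ≤ Literature.Analysis.FluidPDE.meanDissipation (ν j) (u j) := fun j =>
    hfl (ν j) (hνp j) ((hνlt j).trans_le (min_le_left _ _)) (u j) (U j) (hLH j) (hl j) (hsym j) (hbd j)
  exact ⟨tgForce, hfs, hfd, hfz, ν, fun _ => 0, u, hνp, hνlim, hLH, ⟨E, hEn⟩, ε₀, hε₀, hDiss⟩

/-- The two halves recombine to the route's `closes` (sanity: nothing was lost in the factorisation). -/
theorem closes_via_restFamilyFloor (hA : MirrorFloorTG) (hB : MirrorBoundedFromRestTG) : _root_.AnomalousDissipation :=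
  anomalousDissipation_of_restFamilyFloorTG (restFamilyFloorTG_of_mirrorFloorTG hA) hB


/-! ## §R2 The ν-LADDER `FreeFloorPowerK a`: rung `a = 0` landed, rung `a = 1` = the crux, nothing known between -/

/-- **`FreeFloorPowerK a` — the free floor at power `1 − a`.** For `f = f_TG` and every level `E` there are
`c, ν₀ > 0` such that for `ν ∈ (0,ν₀)` every relaxed stationary K-statistic of `NS_ν(f_TG)` below energy `E`
dissipates at least `c ν^{1−a}`. Rung `a = 0` (`ε ≥ cν`, the laminar / anti-pumping floor) is LANDED
(`freeFloorPowerK_zero`); rung `a = 1` (`ε ≥ c`) is the crux (`freeFloorPowerK_one_iff`); rungs decrease in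
strength as `a` decreases (`FreeFloorPowerK.anti`). NO rung with `a > 0` is known for any steadily forced 3-D
Navier–Stokes flow or statistic (census S11: CKG 2001 §6–7, DF 2002 — printed lower bounds are laminar, `a = 0`,
and attained by laminar states of neighbouring forces); in 2-D the rungs `a > 1/2` are FALSE (Alexakis–Doering 2006,
`Literature.Barriers.AnomalousDissipation.AlexakisDoering2006_energyDissipationBound`). -/
def FreeFloorPowerK (a : ℝ) : Prop :=
  ∀ f, IsTG f → ∀ E : ℝ, 0 < E → ∃ c ν₀ : ℝ, 0 < c ∧ 0 < ν₀ ∧ ∀ ν : ℝ, 0 < ν → ν < ν₀ →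
    ∀ μ : Measure (Torus.energySpace (Fin 3)), IsRelaxedK ν E f μ → c * ν ^ (1 - a) ≤ Torus.ensembleDissipation ν μ

/-- **Rung `a = 0` (LANDED): the free floor `ε(μ) ≥ (π/4)ν` for `ν < 1/64`** (`fixedViscosity_floor_explicit`,
p151616; no symmetry and no energy inequality are even needed). -/
theorem freeFloorPowerK_zero : FreeFloorPowerK 0 := by
  intro f hf E _
  have hf' : f = tgForce := hf
  subst hf'
  refine ⟨Real.pi / 4, 64⁻¹, by positivity, by positivity, fun ν hν hνlt μ hμ => ?_⟩
  obtain ⟨hP, -, hball, hG, hL, hW, -⟩ := hμ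
  have h := fixedViscosity_floor_explicit hν hνlt.le hP hball hG hL hW
  have h1 : ν ^ ((1 : ℝ) - 0) = ν := by norm_num
  rw [h1]
  exact h

/-- **Rung `a = 1` IS the crux** (dual, bundled form). -/
theorem freeFloorPowerK_one_iff : FreeFloorPowerK 1 ↔ MirrorLawsLoudK := by
  constructor
  · intro h f hf E hE
    obtain ⟨c, ν₀, hc, hν₀, hfl⟩ := h f hf E hE
    refine ⟨c, ν₀, hc, hν₀, fun ν hν hνlt μ hμ => ?_⟩
    have := hfl ν hν hνlt μ hμ
    have h1 : ν ^ ((1 : ℝ) - 1) = 1 := by norm_num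
    rwa [h1, mul_one] at this
  · intro h f hf E hE
    obtain ⟨ε₀, ν₀, hε₀, hν₀, hL⟩ := h f hf E hE
    refine ⟨ε₀, ν₀, hε₀, hν₀, fun ν hν hνlt μ hμ => ?_⟩
    have h1 : ν ^ ((1 : ℝ) - 1) = 1 := by norm_num
    rw [h1, mul_one]
    exact hL ν hν hνlt μ hμ

/-- **Monotonicity of the ladder**: a higher rung implies every lower rung (for `ν < 1`, `ν^{1−b} ≤ ν^{1−a}` when
`a ≤ b`). -/
theorem FreeFloorPowerK.anti {a b : ℝ} (hab : a ≤ b) (h : FreeFloorPowerK b) : FreeFloorPowerK a := by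
  intro f hf E hE
  obtain ⟨c, ν₀, hc, hν₀, hfl⟩ := h f hf E hE
  refine ⟨c, min ν₀ 1, hc, lt_min hν₀ one_pos, fun ν hν hνlt μ hμ => ?_⟩
  have hν1 : ν ≤ 1 := (hνlt.trans_le (min_le_right _ _)).le
  have hpow : ν ^ (1 - a) ≤ ν ^ (1 - b) :=
    Real.rpow_le_rpow_of_exponent_ge hν hν1 (by linarith)
  calc c * ν ^ (1 - a) ≤ c * ν ^ (1 - b) := mul_le_mul_of_nonneg_left hpow hc.le
    _ ≤ Torus.ensembleDissipation ν μ := hfl ν hν (hνlt.trans_le (min_le_left _ _)) μ hμ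

/-- **The crux sits at the TOP of the ladder**: it gives every rung `a ≤ 1`. -/
theorem freeFloorPowerK_of_mirrorLawsLoudK (h : MirrorLawsLoudK) {a : ℝ} (ha : a ≤ 1) : FreeFloorPowerK a :=
  (freeFloorPowerK_one_iff.2 h).anti ha

/-- Same, from the crux by name. -/
theorem freeFloorPowerK_of_mirrorFloorTG (hA : MirrorFloorTG) {a : ℝ} (ha : a ≤ 1) : FreeFloorPowerK a :=
  freeFloorPowerK_of_mirrorLawsLoudK (mirrorLawsLoudK_iff_mirrorFloorTG.2 hA) ha

/-! ## §R3 Kolmogorov's dimensionless law as the DOMINATING HYPOTHESIS: `StatDragLawK → MirrorLawsLoudK` -/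

/-- **Mean-energy floor of relaxed statistics (anti-pumping, PROVED).** Every relaxed stationary statistic of
`NS_ν(f_TG)` — probability on `H` carried by a ball, finite mean enstrophy, cylindrical Liouville identities,
integrable work; NO symmetry, NO energy inequality — with dissipation `ε(μ) ≤ 1` and `ν ≤ 1/(192π²)` has mean
energy `∫|u|²dμ ≥ 1/(16π)`: the force must be held by an `O(1)` Reynolds stress (`¼ + ∫I dμ ≤ ½(12π²νε)^{1/2}`,
`|I(u)| ≤ 2π|u|²`). -/
theorem meanEnergy_floor_of_relaxed {ν ρ : ℝ} (hν : 0 < ν) (hνs : ν ≤ 1 / (192 * Real.pi ^ 2))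
    {μ : Measure (Torus.energySpace (Fin 3))} (hP : IsProbabilityMeasure μ) (hball : ∀ᵐ u ∂μ, ‖u‖ ^ 2 ≤ ρ)
    (hG : Torus.ensembleEnstrophy μ < ⊤)
    (hL : ∀ Φ : Torus.CylindricalTest (Fin 3),
      Integrable (fun u => Torus.nsGeneratorPairing ν tgForce u (Φ.grad u)) μ ∧
        ∫ u, Torus.nsGeneratorPairing ν tgForce u (Φ.grad u) ∂μ = 0)
    (hW : Integrable (fun u : Torus.energySpace (Fin 3) => Torus.pairing u.1 tgForce) μ)
    (hε : Torus.ensembleDissipation ν μ ≤ 1) :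
    1 / (16 * Real.pi) ≤ ∫ u, ‖u‖ ^ 2 ∂μ := by
  have hA := antiPumping_tg hν hP hball hG hL hW
  have hε0 : 0 ≤ Torus.ensembleDissipation ν μ := by rw [Torus.ensembleDissipation]; positivity
  have hIint : Integrable (fun u : Torus.energySpace (Fin 3) => Torus.inertialPairing u.1 tgForce) μ := by
    refine Integrable.mono' ((integrable_norm_sq_of_ensembleEnstrophy_lt_top μ hG).const_mul (2 * Real.pi))
      (Torus.continuous_inertialPairing_coe isSmooth_tgForce).aestronglyMeasurable ?_
    exact ae_of_all _ fun u => by rw [Real.norm_eq_abs]; exact abs_inertialPairing_tgForce_le_energy u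
  have hI : -(2 * Real.pi * ∫ u, ‖u‖ ^ 2 ∂μ) ≤ ∫ u, Torus.inertialPairing u.1 tgForce ∂μ := by
    rw [← integral_const_mul, ← integral_neg]
    refine integral_mono ((integrable_norm_sq_of_ensembleEnstrophy_lt_top μ hG).const_mul _).neg hIint fun u => ?_
    have := neg_abs_le (Torus.inertialPairing u.1 tgForce)
    dsimp only
    linarith [abs_inertialPairing_tgForce_le_energy u]
  -- the square-root term is `≤ 1/8` since `12π²νε ≤ 12π²ν ≤ 1/16`
  have hsq : 2⁻¹ * Real.sqrt (12 * Real.pi ^ 2 * ν * Torus.ensembleDissipation ν μ) ≤ 8⁻¹ := by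
    have h1 : 12 * Real.pi ^ 2 * ν * Torus.ensembleDissipation ν μ ≤ (4⁻¹ : ℝ) ^ 2 := by
      have h2 : 12 * Real.pi ^ 2 * ν ≤ 16⁻¹ := by
        have := mul_le_mul_of_nonneg_left hνs (by positivity : (0 : ℝ) ≤ 12 * Real.pi ^ 2)
        rw [show 12 * Real.pi ^ 2 * (1 / (192 * Real.pi ^ 2)) = (16⁻¹ : ℝ) by field_simp; ring] at this
        exact this
      have h3 : 12 * Real.pi ^ 2 * ν * Torus.ensembleDissipation ν μ ≤ 12 * Real.pi ^ 2 * ν * 1 :=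
        mul_le_mul_of_nonneg_left hε (by positivity)
      nlinarith
    have h4 : Real.sqrt (12 * Real.pi ^ 2 * ν * Torus.ensembleDissipation ν μ) ≤ 4⁻¹ := by
      rw [← Real.sqrt_sq (by norm_num : (0 : ℝ) ≤ 4⁻¹)]
      exact Real.sqrt_le_sqrt h1
    linarith
  have h8 : 8⁻¹ ≤ 2 * Real.pi * ∫ u, ‖u‖ ^ 2 ∂μ := by linarith
  rw [div_le_iff₀ (by positivity)]
  nlinarith [Real.pi_pos]

/-- **`StatDragLawK` — Kolmogorov's dimensionless zeroth law `β = εℓ/U³ ≥ β₀` for relaxed K-statistics**: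
for `f = f_TG` and every level `E` there are `c, ν₀ > 0` such that for `ν ∈ (0,ν₀)` every relaxed stationary
K-statistic below energy `E` has `ε(μ) ≥ c (∫|u|²dμ)^{3/2}`. This is the natural DOMINATING hypothesis of the crux
(census S10): it is the summit's own dimensionless form transcribed to statistics, and it implies the crux
(`mirrorLawsLoudK_of_statDragLawK`) because anti-pumping bounds the mean energy from below. -/
def StatDragLawK : Prop :=
  ∀ f, IsTG f → ∀ E : ℝ, 0 < E → ∃ c ν₀ : ℝ, 0 < c ∧ 0 < ν₀ ∧ ∀ ν : ℝ, 0 < ν → ν < ν₀ →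
    ∀ μ : Measure (Torus.energySpace (Fin 3)), IsRelaxedK ν E f μ →
      c * (∫ u, ‖u‖ ^ 2 ∂μ) ^ ((3 : ℝ) / 2) ≤ Torus.ensembleDissipation ν μ

/-- **The β-law implies the crux (PROVED)**: with `ε₀ := min 1 (c (16π)^{-3/2})` and `ν₀ := min ν₀ (1/(192π²))`,
either `ε(μ) > 1 ≥ ε₀`, or the mean-energy floor `∫|u|² ≥ 1/(16π)` turns the drag law into `ε(μ) ≥ c(16π)^{-3/2}`. -/
theorem mirrorLawsLoudK_of_statDragLawK (h : StatDragLawK) : MirrorLawsLoudK := by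
  intro f hf E hE
  obtain ⟨c, ν₀, hc, hν₀, hd⟩ := h f hf E hE
  have hf' : f = tgForce := hf
  subst hf'
  have hb0 : (0 : ℝ) < 1 / (16 * Real.pi) := by positivity
  refine ⟨min 1 (c * (1 / (16 * Real.pi)) ^ ((3 : ℝ) / 2)), min ν₀ (1 / (192 * Real.pi ^ 2)),
    lt_min one_pos (mul_pos hc (Real.rpow_pos_of_pos hb0 _)), lt_min hν₀ (by positivity),
    fun ν hν hνlt μ hμ => ?_⟩
  by_cases hε : Torus.ensembleDissipation ν μ ≤ 1
  · obtain ⟨hP, hsym, hball, hG, hL, hW, hEI⟩ := hμ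
    have hm := meanEnergy_floor_of_relaxed hν (hνlt.le.trans (min_le_right _ _)) hP hball hG hL hW hε
    have hdrag := hd ν hν (hνlt.trans_le (min_le_left _ _)) μ ⟨hP, hsym, hball, hG, hL, hW, hEI⟩
    have hpow : (1 / (16 * Real.pi)) ^ ((3 : ℝ) / 2) ≤ (∫ u, ‖u‖ ^ 2 ∂μ) ^ ((3 : ℝ) / 2) :=
      Real.rpow_le_rpow hb0.le hm (by norm_num)
    calc min 1 (c * (1 / (16 * Real.pi)) ^ ((3 : ℝ) / 2)) ≤ c * (1 / (16 * Real.pi)) ^ ((3 : ℝ) / 2) :=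
          min_le_right _ _
      _ ≤ c * (∫ u, ‖u‖ ^ 2 ∂μ) ^ ((3 : ℝ) / 2) := mul_le_mul_of_nonneg_left hpow hc.le
      _ ≤ Torus.ensembleDissipation ν μ := hdrag
  · push Not at hε
    exact (min_le_left _ _).trans hε.le

/-- Hence the β-law closes the crux by name. -/
theorem mirrorFloorTG_of_statDragLawK (h : StatDragLawK) : MirrorFloorTG :=
  mirrorLawsLoudK_iff_mirrorFloorTG.1 (mirrorLawsLoudK_of_statDragLawK h)

/-! ## §R4 The ν-UNIFORM (Euler-level) certificate at ONE level `E` -/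

/-- **The crux at ONE level `E`** (the crux is `∀ E > 0, FloorAtLevelTG E`, `mirrorFloorTG_iff_forall_level`;
the route's `closes` consumes it at the single level produced by crux #3). -/
def FloorAtLevelTG (E : ℝ) : Prop :=
  ∀ f : UnitAddTorus (Fin 3) → EuclideanSpace ℝ (Fin 3), IsTG f → ∃ (ε₀ ν₀ : ℝ), 0 < ε₀ ∧ 0 < ν₀ ∧ ∀ ν : ℝ, 0 < ν → ν < ν₀ → ∃ (Φ₁ : Literature.Analysis.FluidPDE.Torus.CylindricalTest (Fin 3)) (θ₁ : ℝ), θ₁ ≤ 0 ∧ ∀ u : Literature.Analysis.FunctionSpaces.Torus.energySpace (Fin 3), let uf : UnitAddTorus (Fin 3) → EuclideanSpace ℝ (Fin 3) := ((u : MeasureTheory.Lp (EuclideanSpace ℝ (Fin 3)) 2 (MeasureTheory.volume : MeasureTheory.Measure (UnitAddTorus (Fin 3)))) : UnitAddTorus (Fin 3) → EuclideanSpace ℝ (Fin 3)); let D : ℝ := ν * (Literature.Analysis.FunctionSpaces.Torus.eGradNormSq uf).toReal; let P : ℝ := Literature.Analysis.FluidPDE.Torus.pairing (u : MeasureTheory.Lp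 (EuclideanSpace ℝ (Fin 3)) 2 (MeasureTheory.volume : MeasureTheory.Measure (UnitAddTorus (Fin 3)))) f - D; (∀ i j : Fin 3, (fun x => uf (Function.update x i (-x i)) j) =ᵐ[MeasureTheory.volume] (fun x => if j = i then -(uf x j) else uf x j)) → Literature.Analysis.FunctionSpaces.Torus.eGradNormSq uf ≠ ⊤ → ‖u‖ ^ 2 ≤ E → ε₀ ≤ D + Literature.Analysis.FluidPDE.Torus.nsGeneratorPairing ν f u (Φ₁.grad u) + 2 * θ₁ * P

theorem mirrorFloorTG_iff_forall_level : MirrorFloorTG ↔ ∀ E : ℝ, 0 < E → FloorAtLevelTG E :=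
  ⟨fun h E hE f hf => h f hf E hE, fun h f hf E hE => h E hE f hf⟩

/-- **`UniformCertificateLevelTG E` — ONE certificate for ALL small `ν` at level `E`** (the quantifier swap
`∃(Φ₁,θ₁,ε₀) ∀ν<ν₀`; formally the `ν → 0` shadow of such a certificate is a bounded cylindrical-plus-energy Lyapunov
function forcing escape from the `E`-ball under forced EULER in `Fix K`). TRUE below `1/(8π)`
(`uniformCertificateLevelTG_below_inv_eight_pi`), and it gives the crux at that level (`UniformCertificateLevelTG.floorAt`);
census S13: its reach is EXACTLY the linear reach `E_lin ∈ [0.0723, 0.1225]` (paper-level: K-symmetric solenoidal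
microstructure with `P_N u = 0` at the origin fibre realises any psd stress below the ball budget, so a ν-uniform
certificate forces `(f_TG, Φ₁'(0)) − E·Λ(Φ₁'(0)) ≥ ε₀`, i.e. `E < E_lin`). -/
def UniformCertificateLevelTG (E : ℝ) : Prop :=
  ∀ f : UnitAddTorus (Fin 3) → EuclideanSpace ℝ (Fin 3), IsTG f → ∃ (Φ₁ : Literature.Analysis.FluidPDE.Torus.CylindricalTest (Fin 3)) (θ₁ ε₀ ν₀ : ℝ), θ₁ ≤ 0 ∧ 0 < ε₀ ∧ 0 < ν₀ ∧ ∀ ν : ℝ, 0 < ν → ν < ν₀ → ∀ u : Literature.Analysis.FunctionSpaces.Torus.energySpace (Fin 3), let uf : UnitAddTorus (Fin 3) → EuclideanSpace ℝ (Fin 3) := ((u : MeasureTheory.Lp (EuclideanSpace ℝ (Fin 3)) 2 (MeasureTheory.volume : MeasureTheory.Measure (UnitAddTorus (Fin 3)))) : UnitAddTorus (Fin 3) → EuclideanSpace ℝ (Fin 3)); let D : ℝ := ν * (Literature.Analysis.FunctionSpaces.Torus.eGradNormSq uf).toReal; let P : ℝ := Literature.Analysis.FluidPDE.Torus.pairing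 (u : MeasureTheory.Lp (EuclideanSpace ℝ (Fin 3)) 2 (MeasureTheory.volume : MeasureTheory.Measure (UnitAddTorus (Fin 3)))) f - D; (∀ i j : Fin 3, (fun x => uf (Function.update x i (-x i)) j) =ᵐ[MeasureTheory.volume] (fun x => if j = i then -(uf x j) else uf x j)) → Literature.Analysis.FunctionSpaces.Torus.eGradNormSq uf ≠ ⊤ → ‖u‖ ^ 2 ≤ E → ε₀ ≤ D + Literature.Analysis.FluidPDE.Torus.nsGeneratorPairing ν f u (Φ₁.grad u) + 2 * θ₁ * P

/-- A ν-uniform certificate at level `E` gives the crux at level `E` (trivial direction of the quantifier swap). -/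
theorem UniformCertificateLevelTG.floorAt {E : ℝ} (h : UniformCertificateLevelTG E) : FloorAtLevelTG E := by
  intro f hf
  obtain ⟨Φ₁, θ₁, ε₀, ν₀, hθ, hε₀, hν₀, hfl⟩ := h f hf
  exact ⟨ε₀, ν₀, hε₀, hν₀, fun ν hν hνlt => ⟨Φ₁, θ₁, hθ, hfl ν hν hνlt⟩⟩

/-- **Below `1/(8π)` the ν-uniform certificate EXISTS** (`θ₁ = 0`, the work functional; from the landed
`floor_uniform_below_inv_eight_pi`, p151616). -/
theorem uniformCertificateLevelTG_below_inv_eight_pi (E : ℝ) (hE : 0 < E) (hE1 : E < 1 / (8 * Real.pi)) :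
    UniformCertificateLevelTG E := by
  intro f hf
  have hf' : f = tgForce := hf
  subst hf'
  obtain ⟨Φ, ν₀, hν₀, -, hfloor⟩ := floor_uniform_below_inv_eight_pi E hE hE1
  have hm0 : 0 < (4⁻¹ - 2 * Real.pi * E) / 2 := by
    have h1 : 2 * Real.pi * E < 2 * Real.pi * (1 / (8 * Real.pi)) := mul_lt_mul_of_pos_left hE1 Real.two_pi_pos
    have h2 : 2 * Real.pi * (1 / (8 * Real.pi)) = 4⁻¹ := by field_simp; ring
    linarith
  refine ⟨Φ, 0, (4⁻¹ - 2 * Real.pi * E) / 2, ν₀, le_rfl, hm0, hν₀, fun ν hν hνlt u _ _ hu => ?_⟩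
  have := hfloor ν hν hνlt u hu
  simp only [mul_zero, zero_mul, add_zero]
  exact this

/-! ## Sanity: the typed statements are well-formed propositions about the crux's objects -/

example : Prop := RestFamilyFloorTG ∧ FreeFloorPowerK (1 / 2) ∧ StatDragLawK ∧ UniformCertificateLevelTG 1 ∧ FloorAtLevelTG 1

end Summit.AnomalousDissipation.AnomalousDissipation.Cruxes.MirrorFloorTG.StrategistCensusR1

end
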